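import Mathlib
import Summits.ValiantsHypothesis.ValiantsHypothesis.Theorems.NewtonUnitEquationsNewtonTauWeakCornerWords

/-!
# `NewtonTauWeak` (stmt-ValiantsHypothesis-5904), stub `fixedKCoincidence_t2_K3` (siege k13): truncated
# division of univariate unit factors

Support file of siege k13 (univariate algebra only).  At a three-fold corner the landed corner rigidity lemma
(`NewtonTauWeakCorner.corner_rigidity`) is stated for `κ₁ ΠU + κ₂ ΠW - 1`, i.e. AFTER dividing by the third unit
product.  We divide without power series: for `U₁, U₃ ∈ ℂ[s]` with constant term `1` and `R` beyond the degrees,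
`k13_exists_trunc_quotient` produces `U'` (the truncation below `s^R` of `U₁ · Σ_{i<R} (1 - U₃)^i`) with
`U₃ · U' = U₁ + s^R · J`, `U'(0) = 1`, `deg U' < R`, and — the point of the construction — the SAME corner order as
`U₁ - U₃` (`IsOrder U' k ↔ IsOrder (U₁ - U₃) k`; in particular `U'` is inactive when `U₁ = U₃`, so no fake
activity is created by the truncation).  No definitions. [folklore]
-/

-- the namespace mandated for this Theorems file repeats the component `ValiantsHypothesis`
set_option linter.dupNamespace false

noncomputable section

open scoped BigOperators Polynomial
open Polynomial

namespace Summit.ValiantsHypothesis.ValiantsHypothesis.Theorems.NewtonTauWeakSiegeK13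

open Summit.ValiantsHypothesis.ValiantsHypothesis.Theorems.NewtonTauWeakCorner (IsOrder Active exists_isOrder)

/-- The truncated geometric inverse: `P · Σ_{i<R} (1-P)^i = 1 + s^R · J` when `P(0) = 1`. [folklore] -/
theorem exists_mul_geom_eq (P : ℂ[X]) (hP : P.coeff 0 = 1) (R : ℕ) :
    ∃ J : ℂ[X], P * (∑ i ∈ Finset.range R, (1 - P) ^ i) = 1 + X ^ R * J := by
  have hgeom : P * (∑ i ∈ Finset.range R, (1 - P) ^ i) = 1 - (1 - P) ^ R := by
    have := mul_neg_geom_sum (1 - P) R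
    rwa [sub_sub_cancel] at this
  have hdvd : (X : ℂ[X]) ^ R ∣ (1 - P) ^ R := by
    refine pow_dvd_pow_of_dvd ?_ R
    rw [X_dvd_iff]
    simp [hP]
  obtain ⟨J₀, hJ₀⟩ := hdvd
  refine ⟨-J₀, ?_⟩
  rw [hgeom, hJ₀]; ring

/-- The constant term of the truncated geometric inverse is `1` (for `R ≥ 1`). [folklore] -/
theorem coeff_zero_geom (P : ℂ[X]) (hP : P.coeff 0 = 1) {R : ℕ} (hR : 1 ≤ R) :
    (∑ i ∈ Finset.range R, (1 - P) ^ i).coeff 0 = 1 := by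
  rw [finsetSum_coeff, Finset.sum_eq_single_of_mem 0 (Finset.mem_range.mpr (by omega))]
  · simp
  · intro i _ hi
    rw [coeff_zero_eq_eval_zero, eval_pow, ← coeff_zero_eq_eval_zero]
    simp [hP, zero_pow hi]

/-- Coefficients below `R` are not changed by reduction modulo `s^R`. [folklore] -/
theorem coeff_modByMonic_X_pow (p : ℂ[X]) (R : ℕ) {j : ℕ} (hj : j < R) : (p %ₘ X ^ R).coeff j = p.coeff j := by
  have h := modByMonic_add_div p (X ^ R)
  have h' : (p %ₘ X ^ R + X ^ R * (p /ₘ X ^ R)).coeff j = p.coeff j := by rw [h]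
  rw [coeff_add, coeff_X_pow_mul', if_neg (not_le.mpr hj), add_zero] at h'
  exact h'

/-- Coefficients at or above `R` vanish after reduction modulo `s^R`. [folklore] -/
theorem coeff_modByMonic_X_pow_eq_zero (p : ℂ[X]) {R : ℕ} (hR : 1 ≤ R) {j : ℕ} (hj : R ≤ j) :
    (p %ₘ X ^ R).coeff j = 0 := by
  apply coeff_eq_zero_of_natDegree_lt
  have h := natDegree_modByMonic_lt p (monic_X_pow R) (by
    intro h1
    have := congrArg natDegree h1
    rw [natDegree_X_pow, natDegree_one] at this
    omega)
  rw [natDegree_X_pow] at h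
  omega

/-- Low coefficients of a product with a factor of order `o`: below `o` they vanish, at `o` the product picks the
constant term of the other factor. [folklore] -/
theorem coeff_mul_of_isOrder (Q Δ : ℂ[X]) (hΔ0 : Δ.coeff 0 = 0) {o : ℕ} (ho : IsOrder Δ o) :
    (∀ j, j < o → (Q * Δ).coeff j = 0) ∧ (Q * Δ).coeff o = Q.coeff 0 * Δ.coeff o := by
  have hlow : ∀ b, b < o → Δ.coeff b = 0 := by
    intro b hb
    rcases Nat.eq_zero_or_pos b with rfl | hpos
    · exact hΔ0
    · exact ho.2.2 b hpos hb
  constructor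
  · intro j hj
    rw [coeff_mul]
    refine Finset.sum_eq_zero fun ab hab => ?_
    have hb : ab.2 ≤ j := by
      have : ab.1 + ab.2 = j := by simpa using hab
      omega
    rw [hlow ab.2 (by omega), mul_zero]
  · rw [coeff_mul, Finset.sum_eq_single_of_mem (0, o) (by simp)]
    intro ab hab hne
    have hsum : ab.1 + ab.2 = o := by simpa using hab
    by_cases hb : ab.2 < o
    · rw [hlow ab.2 hb, mul_zero]
    · exfalso
      apply hne
      have h2 : ab.2 = o := by omega
      have h1 : ab.1 = 0 := by omega
      exact Prod.ext h1 h2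

/-- **Truncated division of unit factors.**  For `U₁, U₃` with constant term `1` and degrees `< R` there is `U'`
with `U₃ U' = U₁ + s^R J`, `U'(0) = 1`, `deg U' < R`, and the corner order of `U'` is that of `U₁ - U₃`. [folklore] -/
theorem k13_exists_trunc_quotient (U₁ U₃ : ℂ[X]) (h1 : U₁.coeff 0 = 1) (h3 : U₃.coeff 0 = 1) {R : ℕ}
    (hR1 : U₁.natDegree < R) (hR3 : U₃.natDegree < R) :
    ∃ U' J : ℂ[X], U₃ * U' = U₁ + X ^ R * J ∧ U'.coeff 0 = 1 ∧ U'.natDegree < R ∧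
      (∀ k, IsOrder U' k ↔ IsOrder (U₁ - U₃) k) := by
  have hR : 1 ≤ R := by omega
  set Q : ℂ[X] := ∑ i ∈ Finset.range R, (1 - U₃) ^ i with hQ
  obtain ⟨J₀, hJ₀⟩ := exists_mul_geom_eq U₃ h3 R
  set U' : ℂ[X] := (Q * U₁) %ₘ X ^ R with hU'
  have hQ0 : Q.coeff 0 = 1 := coeff_zero_geom U₃ h3 hR
  -- the division identity
  have hdiv : U₃ * U' = U₁ + X ^ R * (J₀ * U₁ - U₃ * ((Q * U₁) /ₘ X ^ R)) := by
    have hmod : U' = Q * U₁ - X ^ R * ((Q * U₁) /ₘ X ^ R) := by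
      rw [hU', modByMonic_eq_sub_mul_div (Q * U₁) (X ^ R)]
    rw [hmod, mul_sub, ← mul_assoc, hJ₀]; ring
  -- low coefficients of `U'`
  have hlowU' : ∀ j, j < R → U'.coeff j = (Q * U₁).coeff j := fun j hj => coeff_modByMonic_X_pow _ R hj
  -- `Q U₁ = (1 + X^R J₀) + Q Δ`
  set Δ : ℂ[X] := U₁ - U₃ with hΔ
  have hQU₁ : Q * U₁ = (1 + X ^ R * J₀) + Q * Δ := by rw [← hJ₀, hΔ]; ring
  have hΔ0 : Δ.coeff 0 = 0 := by rw [hΔ, coeff_sub, h1, h3, sub_self]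
  have hmidU' : ∀ j, 1 ≤ j → j < R → U'.coeff j = (Q * Δ).coeff j := by
    intro j hj1 hjR
    rw [hlowU' j hjR, hQU₁, coeff_add, coeff_add, coeff_one, coeff_X_pow_mul', if_neg (by omega),
      if_neg (by omega)]
    ring
  have hU'0 : U'.coeff 0 = 1 := by
    rw [hlowU' 0 (by omega), mul_coeff_zero, hQ0, h1, mul_one]
  have hdegU' : U'.natDegree < R := by
    by_cases hz : U' = 0
    · rw [hz, natDegree_zero]; omega
    · rw [Nat.lt_iff_add_one_le]
      by_contra hlt
      push Not at hlt
      have := coeff_modByMonic_X_pow_eq_zero (Q * U₁) hR (j := U'.natDegree) (by omega)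
      rw [← hU'] at this
      exact hz (leadingCoeff_eq_zero.mp this)
  have hΔdeg : Δ.natDegree < R := (natDegree_sub_le U₁ U₃).trans_lt (max_lt hR1 hR3)
  -- order transfer, `←`
  have hback : ∀ k, IsOrder Δ k → IsOrder U' k := by
    intro k hk
    have hkR : k < R := lt_of_le_of_lt hk.le_natDegree hΔdeg
    obtain ⟨hlow, hat⟩ := coeff_mul_of_isOrder Q Δ hΔ0 hk
    refine ⟨hk.1, ?_, fun j hj1 hjk => ?_⟩
    · rw [hmidU' k hk.1 hkR, hat, hQ0, one_mul]
      exact hk.2.1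
    · rw [hmidU' j hj1 (by omega)]
      exact hlow j hjk
  refine ⟨U', J₀ * U₁ - U₃ * ((Q * U₁) /ₘ X ^ R), hdiv, hU'0, hdegU', fun k => ⟨fun hk => ?_, hback k⟩⟩
  -- order transfer, `→`
  have hkR : k < R := by
    by_contra hge
    push Not at hge
    have := coeff_modByMonic_X_pow_eq_zero (Q * U₁) hR hge
    rw [← hU'] at this
    exact hk.2.1 this
  have hΔne : Δ ≠ 0 := by
    intro hΔz
    have h0 : (Q * Δ).coeff k = 0 := by rw [hΔz, mul_zero, coeff_zero]
    have := hmidU' k hk.1 hkR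
    rw [h0] at this
    exact hk.2.1 this
  have hex : ∃ j, 1 ≤ j ∧ Δ.coeff j ≠ 0 := by
    by_contra hall
    push Not at hall
    apply hΔne
    ext j
    rcases Nat.eq_zero_or_pos j with rfl | hpos
    · rw [hΔ0, coeff_zero]
    · rw [hall j hpos, coeff_zero]
  obtain ⟨o, hoΔ⟩ := exists_isOrder hex
  have hoU' := hback o hoΔ
  rwa [hk.unique hoU']

end Summit.ValiantsHypothesis.ValiantsHypothesis.Theorems.NewtonTauWeakSiegeK13

end
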